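/-
Copyright (c) 2026 the pub-hodgecm-mathlib formalisation cell (harness21).  Prover seat hodgecm-mathlib-K2Liu-p25 (g0), Track B «K2-LIT» ∕ hLiu418
#184♮ = `stmt-HodgeConjecture-24832`, Road Φ ∕ socket #41, organ G5-a (Φ7-2), face (β0) ∕ (u-0c): the `ξ`∕`a` letters of ★ I1 p861931
`K2LiuSiegelMiddleTermInnerFamily` (`hξ`, `ha`) and of ★ I3 p861665 `K2LiuSiegelMiddleTermKTypes.exists_KTypes_package` (`ha_mul hCa ha_cont ha_lev`).  THEOREMS ONLY.
-/
import Summits.HodgeConjecture.HodgeConjecture.Theorems.K2LiuGL2FlatSectionFiniteData   -- ★ (β4-v) D2a `ofFinite_mem` (+ `glFiniteIntegralLevel`, `GLn.evalAt`, `congruenceGL`)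
import Literature.NumberTheory.Automorphic.MatrixAdeleModule                            -- ★ `adelicAbsDet_eq_one_of_mem_standardMaximalCompactGL`
import Literature.NumberTheory.Automorphic.IdeleClassGroupProofs                         -- ★ `continuous_ideleNorm_holds`, `ideleNorm_ne_zero`
import HarnessLib

/-!
# Crux `HLiu418`, #41 middle term, (u-0c): THE DET-CHARACTER `ξ = χ · |·|^{½}` AND THE LETTERS OF `a = ξ(det ·)⁻¹` — `hξ` of ★ I1 and `ha_mul`, `hCa`, `ha_cont`, `ha_lev` of ★ I3

Cell `hodgecm-mathlib`, crux item hLiu418 = `stmt-HodgeConjecture-24832`; squad K2 ∕ K2Liu; prover K2Liu-p25 (g0).  THEOREMS ONLY (no `def`, no instance, no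
notation, no `sorry`); lane `--supports stmt-HodgeConjecture-24832 --as helper`.

WHY.  The untwisted inner family of the middle term is `φ s x g = a g · b x · F_s(Λ g · k_x)` with `a g = ξ(det g)⁻¹`, `ξ = χ · |·|_𝔸^{½}` (★ I1
`K2LiuSiegelMiddleTermInnerFamily.innerFamily_torus_law`, binders `ξ hξ a ha`); ★ I3 `K2LiuSiegelMiddleTermKTypes.exists_KTypes_package` consumes, for this `a`, the
four letters `ha_mul` (multiplicative on `K = K_∞ GL₂(𝒪̂)`), `hCa` (bounded on `K`), `ha_cont` (continuous on `K`), `ha_lev` (right-invariant under the level).  THIS FILE: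
* §1 **`exists_halfNormTwist`** — `∃ ξ : 𝔸_Lˣ →* ℂˣ, (∀ d, ξ d = χ d · |d|^{½}) ∧ Continuous ξ` (★ I1's `hξ` plus continuity; `|d d′|^{½} = |d|^{½} |d′|^{½}` for the non-negative
  reals `|d|_𝔸`, continuity from ★ `continuous_ideleNorm_holds` and `|d|_𝔸 > 0`).
* §2 for ANY `ξ` with `hξ` and `a` with `ha : a g = ξ(det g)⁻¹`: **`a_mul`** (all of `GL₂(𝔸_L)`), **`ha_mul`**, **`hCa`** with `Ca = 1` (`χ` unitary, `|det k|_𝔸 = 1` on `K` ★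
  `adelicAbsDet_eq_one_of_mem_standardMaximalCompactGL`; in fact `‖a k‖ = 1`, `norm_a_eq_one_of_mem`), **`ha_cont`** (continuity of `ξ`, of `det` and of `k ↦ ↑k`), **`ha_lev`** from
  the ONE `χ`-level letter `hχlev : χ(det r̂) = 1` for `r` in the level with the congruence conditions at `S` (the conductor condition, by value) — conclusions = ★ I3's binders
  `ha_mul hCa ha_cont ha_lev` VERBATIM.
References: [Bump1997, §3.7 (the characters `χ ⊗ |·|^{s}` of `GL₂`)]; [MoeglinWaldspurger1995, I.2.1, II.1.7]; [TateThesis1967, §4.3].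
HONEST LABEL.  Count-neutral helper: `HC_CM` is proved only modulo the 7 printed citations (2 remaining named inputs: hLiu418 = `stmt-HodgeConjecture-24832`,
h413 = `stmt-HodgeConjecture-24833`) until rung 0 closes; closes no socket by itself.
-/

set_option autoImplicit false
set_option linter.dupNamespace false -- the mandated namespace repeats `HodgeConjecture.HodgeConjecture`

noncomputable section

open NumberField IsDedekindDomain
open scoped NNReal Matrix
open Literature.NumberTheory.Automorphic Literature.NumberTheory.GaloisRepresentations
open Summit.HodgeConjecture.HodgeConjecture.Cruxes.HLiu418.K2LiuGL2FlatSectionFiniteData (ofFinite_mem)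

namespace Summit.HodgeConjecture.HodgeConjecture.Cruxes.HLiu418.K2LiuSiegelMiddleTermDetCharacter

variable {L : Type} [Field L] [NumberField L]

/-! ## §1 The det-character `ξ = χ · |·|_𝔸^{½}` -/

/-- the square root of the idele norm is non-zero. [folklore] -/
theorem ideleNorm_cpow_half_ne_zero (d : (AdeleRing (𝓞 L) L)ˣ) : ((IdeleClassGroup.ideleNorm L d : ℝ) : ℂ) ^ (1 / 2 : ℂ) ≠ 0 :=
  Complex.cpow_ne_zero_iff.2 (Or.inl (Complex.ofReal_ne_zero.2 (NNReal.coe_ne_zero.2 (ideleNorm_ne_zero d))))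

/-- **`ξ = χ · |·|_𝔸^{½}` EXISTS AS A CHARACTER `𝔸_Lˣ →* ℂˣ`, and is continuous** — the binder `hξ` of ★ I1 `innerFamily_torus_law`. [cite: Bump1997, §3.7] [cite: TateThesis1967, §4.3] -/
theorem exists_halfNormTwist (χ : HeckeCharacter L) :
    ∃ ξ : (AdeleRing (𝓞 L) L)ˣ →* ℂˣ,
      (∀ d : (AdeleRing (𝓞 L) L)ˣ, ((ξ d : ℂˣ) : ℂ) = ((χ d : ℂˣ) : ℂ) * ((IdeleClassGroup.ideleNorm L d : ℝ) : ℂ) ^ (1 / 2 : ℂ)) ∧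
      Continuous fun d => ((ξ d : ℂˣ) : ℂ) := by
  have hmul : ∀ x y : (AdeleRing (𝓞 L) L)ˣ, ((IdeleClassGroup.ideleNorm L (x * y) : ℝ) : ℂ) ^ (1 / 2 : ℂ) =
      ((IdeleClassGroup.ideleNorm L x : ℝ) : ℂ) ^ (1 / 2 : ℂ) * ((IdeleClassGroup.ideleNorm L y : ℝ) : ℂ) ^ (1 / 2 : ℂ) := fun x y => by
    rw [map_mul, NNReal.coe_mul, Complex.ofReal_mul, Complex.mul_cpow_ofReal_nonneg (NNReal.coe_nonneg _) (NNReal.coe_nonneg _)]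
  let ξ : (AdeleRing (𝓞 L) L)ˣ →* ℂˣ :=
    { toFun := fun d => χ d * Units.mk0 _ (ideleNorm_cpow_half_ne_zero d)
      map_one' := Units.ext (by
        rw [map_one, one_mul, Units.val_mk0, map_one, NNReal.coe_one, Complex.ofReal_one, Complex.one_cpow, Units.val_one])
      map_mul' := fun x y => Units.ext (by
        rw [Units.val_mul, Units.val_mul, Units.val_mul, Units.val_mul, Units.val_mk0, Units.val_mk0, Units.val_mk0, map_mul, Units.val_mul, hmul]
        ring) }
  refine ⟨ξ, fun d => ?_, ?_⟩
  · show (((χ d * Units.mk0 _ (ideleNorm_cpow_half_ne_zero d)) : ℂˣ) : ℂ) = _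
    rw [Units.val_mul, Units.val_mk0]
  · show Continuous fun d => (((χ d * Units.mk0 _ (ideleNorm_cpow_half_ne_zero d)) : ℂˣ) : ℂ)
    simp only [Units.val_mul, Units.val_mk0]
    refine (Units.continuous_val.comp (map_continuous χ)).mul ?_
    refine (Complex.continuous_ofReal.comp (NNReal.continuous_coe.comp (continuous_ideleNorm_holds L))).cpow continuous_const fun d => Or.inl ?_
    rw [Function.comp_apply, Function.comp_apply, Complex.ofReal_re]
    exact NNReal.coe_pos.2 (pos_iff_ne_zero.2 (ideleNorm_ne_zero d))

/-! ## §2 The letters of `a = ξ(det ·)⁻¹` -/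

section ALetters

variable (ξ : (AdeleRing (𝓞 L) L)ˣ →* ℂˣ) (a : GL (Fin 2) (AdeleRing (𝓞 L) L) → ℂ)
  (ha : ∀ g, a g = (((ξ (Matrix.GeneralLinearGroup.det g))⁻¹ : ℂˣ) : ℂ))

include ha in
/-- `a` is multiplicative on all of `GL₂(𝔸_L)`. [cite: Bump1997, §3.7] -/
theorem a_mul (g g' : GL (Fin 2) (AdeleRing (𝓞 L) L)) : a (g * g') = a g * a g' := by
  rw [ha, ha, ha, map_mul, map_mul, mul_inv, Units.val_mul]

include ha in
/-- **`ha_mul`** of ★ I3 `exists_KTypes_package`, VERBATIM. [cite: Bump1997, §3.7] -/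
theorem ha_mul : ∀ k k₀ : ↥(standardMaximalCompactGL 2 L),
    a ((k * k₀ : ↥(standardMaximalCompactGL 2 L)) : GL (Fin 2) (AdeleRing (𝓞 L) L)) = a k * a k₀ := fun k k₀ => by
  rw [Subgroup.coe_mul, a_mul ξ a ha]

include ha in
/-- **`‖a k‖ = 1` on `K`** for `ξ = χ · |·|^{½}` with `χ` unitary (`|det k|_𝔸 = 1` on `K`, ★ `adelicAbsDet_eq_one_of_mem_standardMaximalCompactGL`). [cite: Bump1997, §3.7] [cite: MoeglinWaldspurger1995, I.2.1] -/
theorem norm_a_eq_one_of_mem (χ : HeckeCharacter L) (hχ : χ.IsUnitary)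
    (hξ : ∀ d : (AdeleRing (𝓞 L) L)ˣ, ((ξ d : ℂˣ) : ℂ) = ((χ d : ℂˣ) : ℂ) * ((IdeleClassGroup.ideleNorm L d : ℝ) : ℂ) ^ (1 / 2 : ℂ))
    {k : GL (Fin 2) (AdeleRing (𝓞 L) L)} (hk : k ∈ standardMaximalCompactGL 2 L) : ‖a k‖ = 1 := by
  have h1 : IdeleClassGroup.ideleNorm L (Matrix.GeneralLinearGroup.det k) = 1 := adelicAbsDet_eq_one_of_mem_standardMaximalCompactGL 2 L hk
  rw [ha, Units.val_inv_eq_inv_val, norm_inv, hξ, norm_mul, hχ, one_mul, h1, NNReal.coe_one, Complex.ofReal_one, Complex.one_cpow, norm_one, inv_one]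

include ha in
/-- **`hCa`** of ★ I3 `exists_KTypes_package` with `Ca := 1`, VERBATIM. [cite: Bump1997, §3.7] -/
theorem hCa (χ : HeckeCharacter L) (hχ : χ.IsUnitary)
    (hξ : ∀ d : (AdeleRing (𝓞 L) L)ˣ, ((ξ d : ℂˣ) : ℂ) = ((χ d : ℂˣ) : ℂ) * ((IdeleClassGroup.ideleNorm L d : ℝ) : ℂ) ^ (1 / 2 : ℂ)) :
    ∀ k : ↥(standardMaximalCompactGL 2 L), ‖a k‖ ≤ (1 : ℝ) := fun k =>
  (norm_a_eq_one_of_mem ξ a ha χ hχ hξ k.2).le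

include ha in
/-- **`ha_cont`** of ★ I3 `exists_KTypes_package`, VERBATIM, from the continuity of `ξ` (e.g. §1) — `det` and `k ↦ ↑k` are continuous and `ξ(det k) ≠ 0`. [cite: Bump1997, §3.7] -/
theorem ha_cont (hξc : Continuous fun d => ((ξ d : ℂˣ) : ℂ)) : Continuous fun k : ↥(standardMaximalCompactGL 2 L) => a k := by
  have h : (fun k : ↥(standardMaximalCompactGL 2 L) => a k) =
      fun k : ↥(standardMaximalCompactGL 2 L) => (((ξ (Matrix.GeneralLinearGroup.det (k : GL (Fin 2) (AdeleRing (𝓞 L) L))) : ℂˣ) : ℂ))⁻¹ :=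
    funext fun k => by rw [ha, Units.val_inv_eq_inv_val]
  rw [h]
  exact (hξc.comp (Matrix.GeneralLinearGroup.continuous_det.comp continuous_subtype_val)).inv₀ fun k => Units.ne_zero _

include ha in
/-- **`ha_lev`** of ★ I3 `exists_KTypes_package`, VERBATIM, from the ONE `χ`-level letter `hχlev : χ(det r̂) = 1` on the level with the congruence conditions at `S` (the conductor
condition): `|det r̂|_𝔸 = 1` since `r̂ ∈ K` (★ `ofFinite_mem`, ★ `adelicAbsDet_eq_one_of_mem_standardMaximalCompactGL`), so `ξ(det r̂) = 1` and `a(k r̂) = a(k)`.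
[cite: Bump1997, §3.7] [cite: MoeglinWaldspurger1995, I.2.1] -/
theorem ha_lev (χ : HeckeCharacter L)
    (hξ : ∀ d : (AdeleRing (𝓞 L) L)ˣ, ((ξ d : ℂˣ) : ℂ) = ((χ d : ℂˣ) : ℂ) * ((IdeleClassGroup.ideleNorm L d : ℝ) : ℂ) ^ (1 / 2 : ℂ))
    (S : Finset (HeightOneSpectrum (𝓞 L))) (γl : ∀ v : HeightOneSpectrum (𝓞 L), ValuativeRel.ValueGroupWithZero (v.adicCompletion L))
    (hχlev : ∀ r : GL (Fin 2) (FiniteAdeleRing (𝓞 L) L), r ∈ glFiniteIntegralLevel 2 L → (∀ v ∈ S, GLn.evalAt 2 L v r ∈ congruenceGL 2 (γl v)) →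
      χ (Matrix.GeneralLinearGroup.det (GLn.ofFinite 2 L r)) = 1) :
    ∀ (k : ↥(standardMaximalCompactGL 2 L)) (r : GL (Fin 2) (FiniteAdeleRing (𝓞 L) L)), r ∈ glFiniteIntegralLevel 2 L →
      (∀ v ∈ S, GLn.evalAt 2 L v r ∈ congruenceGL 2 (γl v)) → a ((k : GL (Fin 2) (AdeleRing (𝓞 L) L)) * GLn.ofFinite 2 L r) = a k := by
  intro k r hr hS
  have hN : IdeleClassGroup.ideleNorm L (Matrix.GeneralLinearGroup.det (GLn.ofFinite 2 L r)) = 1 :=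
    adelicAbsDet_eq_one_of_mem_standardMaximalCompactGL 2 L (ofFinite_mem hr)
  have hξ1 : ξ (Matrix.GeneralLinearGroup.det (GLn.ofFinite 2 L r)) = 1 := Units.ext (by
    rw [hξ, hχlev r hr hS, hN, Units.val_one, NNReal.coe_one, Complex.ofReal_one, Complex.one_cpow, mul_one])
  rw [a_mul ξ a ha, ha (GLn.ofFinite 2 L r), hξ1, inv_one, Units.val_one, mul_one]

end ALetters

end Summit.HodgeConjecture.HodgeConjecture.Cruxes.HLiu418.K2LiuSiegelMiddleTermDetCharacter

end
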